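import Literature.Computability.AlgebraicComplexity.WordRearrangementCount
import Literature.Computability.AlgebraicComplexity.BI17FundamentalInvariantForms
import Literature.Computability.AlgebraicComplexity.PlethysmStability
import HarnessLib

/-!
# The polarisation of a product of normalised coordinate functions is a wreath-product count
# (step S1 of the dictionary behind BI 2017 Rem. 3.13) — theorem-only

For words `J_i : [D] → [m]` (`i < d`) in letters `t : [m] → σ`, the product
`∏_i symArrayPoly D t J_i ∈ k[Sym^D]_d` of the normalised coordinate functions
`X_{x_{t∘J}} / #{I : x_I = x_{t∘J}}` (BI 2017 §3.1: forms as symmetric tensors, the summands of the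
tableau invariants `P_T`, eq. (3.4)) has full polarisation
`u ↦ #{(π, ε) ∈ S_d × S_D^d : u_{π(i)} ∘ ε_i = t ∘ J_i ∀ i} / (d! · D!^d)`:
`polarize_prod_symArrayPoly`. The two normalisations (`1/#{I : x_I = x_J}` inside `symArrayPoly`,
`1/#{rearrangements}` inside `arrOf`) are converted into counts over `S_D` and `S_d` by the
orbit–stabiliser identity `card_filter_comp_perm_eq_div` (`WordRearrangementCount.lean`).
THEOREM-ONLY (no definitions, no named facts). [cite: BurgisserIkenmeyer2017, eq. (3.4) and Rem. 3.13]

Honest framing: bookkeeping for the cell `val-lit`; VP ≠ VNP is NOT proved.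

## References

* [BurgisserIkenmeyer2017] P. Bürgisser, C. Ikenmeyer, J. Algebra 477 (2017) 390–434 =
  arXiv:1511.02927, §3.1 eq. (3.4), Rem. 3.13.
-/

noncomputable section

open MvPolynomial

namespace Literature.Computability.AlgebraicComplexity

variable {k : Type*} [Field k] [CharZero k] {σ : Type*} [LinearOrder σ] [Fintype σ]

omit [CharZero k] in
/-- The symmetric array of a monomial `∏_i X_{E i}` at `I`: `[x_E = x_I] / #{I' : x_{I'} = x_I}`.
[folklore] -/
private theorem arrOf_prod_X_eq_ite_div {τ : Type*} [Fintype τ] [DecidableEq τ] {d : ℕ} (E I : Fin d → τ) :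
    arrOf d (∏ i, X (E i) : MvPolynomial τ k) I =
      (if wordExp E = wordExp I then 1 else 0) /
        ((Finset.univ.filter fun I' : Fin d → τ => wordExp I' = wordExp I).card : k) := by
  rw [arrOf, prod_X_eq_monomial_wordExp, coeff_monomial]

/-- `[x_E = x_I] / #{I' : x_{I'} = x_I} = #{π ∈ S_d : I ∘ π = E} / d!` (orbit–stabiliser).
[folklore] -/
private theorem ite_div_card_eq_card_div_factorial {τ : Type*} [Fintype τ] [DecidableEq τ] {d : ℕ}
    (E I : Fin d → τ) :
    (if wordExp E = wordExp I then (1 : k) else 0) /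
        ((Finset.univ.filter fun I' : Fin d → τ => wordExp I' = wordExp I).card : k) =
      (((Finset.univ : Finset (Equiv.Perm (Fin d))).filter
          fun π : Equiv.Perm (Fin d) => I ∘ ⇑π = E).card : k) / (Nat.factorial d : k) := by
  classical
  have hd : (Nat.factorial d : k) ≠ 0 := Nat.cast_ne_zero.mpr (Nat.factorial_ne_zero d)
  rw [card_filter_comp_perm_eq_div k I E]
  by_cases h : wordExp I = wordExp E
  · have hfilt : (Finset.univ.filter fun I' : Fin d → τ => wordExp I' = wordExp I) =
        Finset.univ.filter fun I' : Fin d → τ => wordExp I' = wordExp E := by rw [h]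
    rw [if_pos h.symm, if_pos h, hfilt, div_div_cancel_left' hd, one_div]
  · rw [if_neg (fun h' => h h'.symm), if_neg h, zero_div, zero_div]

/-- **S1 — the polarisation of `∏_i symArrayPoly D t J_i` is a count over `S_d × S_D^d`**:
`Φ(∏_i X̃_{t∘J_i})(u) = #{(π, ε) : u_{π i} ∘ ε_i = t ∘ J_i ∀ i} / (d! D!^d)`.
[cite: BurgisserIkenmeyer2017, eq. (3.4)] -/
theorem polarize_prod_symArrayPoly {m D d : ℕ} (t : Fin m → σ) (J : Fin d → Fin D → Fin m)
    (u : Fin d → Fin D → σ) :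
    polarize D d (∏ i, symArrayPoly (k := k) D t (J i)) u =
      (((Finset.univ : Finset (Equiv.Perm (Fin d) × (Fin d → Equiv.Perm (Fin D)))).filter
          fun ω : Equiv.Perm (Fin d) × (Fin d → Equiv.Perm (Fin D)) =>
            ∀ i, u (ω.1 i) ∘ ⇑(ω.2 i) = t ∘ J i).card : k) /
        ((Nat.factorial d : k) * (Nat.factorial D : k) ^ d) := by
  classical
  have hD : (Nat.factorial D : k) ≠ 0 := Nat.cast_ne_zero.mpr (Nat.factorial_ne_zero D)
  have hd : (Nat.factorial d : k) ≠ 0 := Nat.cast_ne_zero.mpr (Nat.factorial_ne_zero d)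
  -- the normalising constants of the `symArrayPoly`
  set N : Fin d → k := fun i =>
    ((Finset.univ.filter fun I : Fin D → σ => wordExp I = wordExp (t ∘ J i)).card : k) with hN
  have hNi : ∀ i, N i =
      ((Finset.univ.filter fun I : Fin D → σ => wordExp I = wordExp (t ∘ J i)).card : k) :=
    fun _ => rfl
  have hprod : (∏ i, symArrayPoly (k := k) D t (J i)) =
      C (∏ i, (N i)⁻¹) * ∏ i, X (wordDegIdx t (J i)) := by
    simp only [symArrayPoly, hN]
    rw [Finset.prod_mul_distrib, map_prod]
  -- the contents of the blocks of `u`, and of the `t ∘ J i`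
  have hpol : polarize D d (∏ i, symArrayPoly (k := k) D t (J i)) u =
      (∏ i, (N i)⁻¹) * ((((Finset.univ : Finset (Equiv.Perm (Fin d))).filter
          fun π : Equiv.Perm (Fin d) =>
            (fun r => (⟨wordExp (u r), mem_degMonomials_iff.mpr (degree_wordExp _)⟩ : DegIdx σ D)) ∘
              ⇑π = fun i => wordDegIdx t (J i)).card : k) / (Nat.factorial d : k)) := by
    rw [hprod, ← smul_eq_C_mul, polarize_smul]
    have ha := arrOf_prod_X_eq_ite_div (k := k) (fun i => wordDegIdx t (J i))
      (fun r => (⟨wordExp (u r), mem_degMonomials_iff.mpr (degree_wordExp _)⟩ : DegIdx σ D))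
    rw [ite_div_card_eq_card_div_factorial] at ha
    unfold polarize
    rw [ha]
  rw [hpol]
  -- inner level: `[Eu (π i) = E i] / N i = #{ε : u (π i) ∘ ε = t ∘ J i} / D!`
  have hinner : ∀ (π : Equiv.Perm (Fin d)) (i : Fin d),
      (if ((⟨wordExp (u (π i)), mem_degMonomials_iff.mpr (degree_wordExp _)⟩ : DegIdx σ D)) =
          wordDegIdx t (J i) then (1 : k) else 0) * (N i)⁻¹ =
        (((Finset.univ : Finset (Equiv.Perm (Fin D))).filter
            fun ε : Equiv.Perm (Fin D) => u (π i) ∘ ⇑ε = t ∘ J i).card : k) /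
          (Nat.factorial D : k) := by
    intro π i
    have hiff : ((⟨wordExp (u (π i)), mem_degMonomials_iff.mpr (degree_wordExp _)⟩ : DegIdx σ D)) =
        wordDegIdx t (J i) ↔ wordExp (u (π i)) = wordExp (t ∘ J i) := Subtype.ext_iff
    rw [card_filter_comp_perm_eq_div k (u (π i)) (t ∘ J i)]
    by_cases h : wordExp (u (π i)) = wordExp (t ∘ J i)
    · rw [if_pos (hiff.mpr h), if_pos h, one_mul, hNi i, div_div_cancel_left' hD]
    · rw [if_neg (fun h' => h (hiff.mp h')), if_neg h, zero_mul, zero_div]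
  -- the outer count as a sum of indicators, each a product of inner indicators
  have hcount : (((Finset.univ : Finset (Equiv.Perm (Fin d))).filter
      fun π : Equiv.Perm (Fin d) =>
        (fun r => (⟨wordExp (u r), mem_degMonomials_iff.mpr (degree_wordExp _)⟩ : DegIdx σ D)) ∘
          ⇑π = fun i => wordDegIdx t (J i)).card : k) =
        ∑ π : Equiv.Perm (Fin d), ∏ i,
          (if ((⟨wordExp (u (π i)), mem_degMonomials_iff.mpr (degree_wordExp _)⟩ : DegIdx σ D)) =
            wordDegIdx t (J i) then (1 : k) else 0) := by
    rw [Finset.card_filter, Nat.cast_sum]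
    refine Finset.sum_congr rfl fun π _ => ?_
    rw [Fintype.prod_boole, Nat.cast_ite, Nat.cast_one, Nat.cast_zero]
    congr 1
    exact propext ⟨fun h i => congrFun h i, fun h => funext h⟩
  -- assemble
  rw [hcount, Finset.sum_div, Finset.mul_sum]
  have hterm : ∀ π : Equiv.Perm (Fin d),
      (∏ i, (N i)⁻¹) * ((∏ i, (if ((⟨wordExp (u (π i)), mem_degMonomials_iff.mpr (degree_wordExp _)⟩ :
          DegIdx σ D)) = wordDegIdx t (J i) then (1 : k) else 0)) / (Nat.factorial d : k)) =
        (∑ εv : Fin d → Equiv.Perm (Fin D),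
            (if ∀ i, u (π i) ∘ ⇑(εv i) = t ∘ J i then (1 : k) else 0)) /
          ((Nat.factorial d : k) * (Nat.factorial D : k) ^ d) := by
    intro π
    rw [mul_div_assoc', ← Finset.prod_mul_distrib,
      Finset.prod_congr rfl fun i _ => (mul_comm _ _).trans (hinner π i), Finset.prod_div_distrib,
      Finset.prod_const, Finset.card_univ, Fintype.card_fin]
    -- `∏_i #{ε_i} = #{εv}` as a sum of indicators
    have hpi : (∏ i, (((Finset.univ : Finset (Equiv.Perm (Fin D))).filter
        fun ε : Equiv.Perm (Fin D) => u (π i) ∘ ⇑ε = t ∘ J i).card : k)) =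
          ∑ εv : Fin d → Equiv.Perm (Fin D),
            (if ∀ i, u (π i) ∘ ⇑(εv i) = t ∘ J i then (1 : k) else 0) := by
      have h1 : ∀ i, (((Finset.univ : Finset (Equiv.Perm (Fin D))).filter
          fun ε : Equiv.Perm (Fin D) => u (π i) ∘ ⇑ε = t ∘ J i).card : k) =
            ∑ ε : Equiv.Perm (Fin D), (if u (π i) ∘ ⇑ε = t ∘ J i then (1 : k) else 0) := by
        intro i
        rw [Finset.card_filter, Nat.cast_sum]
        refine Finset.sum_congr rfl fun ε _ => ?_
        rw [Nat.cast_ite, Nat.cast_one, Nat.cast_zero]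
      simp_rw [h1]
      rw [Finset.prod_univ_sum (fun _ : Fin d => (Finset.univ : Finset (Equiv.Perm (Fin D))))
        fun i ε => (if u (π i) ∘ ⇑ε = t ∘ J i then (1 : k) else 0), Fintype.piFinset_univ]
      refine Finset.sum_congr rfl fun εv _ => ?_
      rw [Fintype.prod_boole]
      congr 1
    rw [hpi, div_div, mul_comm]
  rw [Finset.sum_congr rfl fun π _ => hterm π, ← Finset.sum_div]
  congr 1
  -- `∑_π ∑_εv [..] = #{ω}`
  rw [Finset.card_filter, Nat.cast_sum, ← Finset.univ_product_univ, Finset.sum_product]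
  refine Finset.sum_congr rfl fun π _ => Finset.sum_congr rfl fun εv _ => ?_
  rw [Nat.cast_ite, Nat.cast_one, Nat.cast_zero]

end Literature.Computability.AlgebraicComplexity

end
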